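import Summits.Ventures.CertifiedManyBodySolver.Downfold.EmeryThermalBandSeam
import Summits.Ventures.CertifiedManyBodySolver.Downfold.EmeryBoxesLa214CLDAFloorWord
import HarnessLib

/-!
# `T > 0` CAP WORDS (hypothesis-free) on La2CuO4 (M13) U-SLICE «cLDA» (U_dd, U_pp) = (10.5, 4.0) [HSC89] — `emeryBoxLa214CLDA` (router/EMERY-FLOOR-ORDERS row 3; COVERAGE BATCH 3)

Venture CertifiedManyBodySolver, cell `pub/hubbard-downfold` (S1 = ROUTER) × crew hubbard-fast S2 (ii) × (iv) «T > 0 × multi-band»; seat hubbard-downfold-mod-4 (S1/S2 Emery seam).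
Namespace `Summit.Ventures.CertifiedManyBodySolver.Downfold`. PATTERN OF `EmeryThermalCapFromFloorSeam` / `EmeryThermalBandSeam`: the floor word `EmeryBoxesLa214CLDAFloorWord` proves the four
tilted CuO₄ certificates `la214CLDAFloor_hq_lowerCorner` (device hubbard-box-p2 kgp1x5 chain, run for batch 3 by this seat, kit j316623); through hubbard-box-p1's R153 they are four
exact-tilt corner CAPS on the cell pressure (§1; tilts μ = (-44/5, -47/5, -47/5, -10), q₀ = (-205183047/2500000, -111591211/1250000, -887542813/10000000, -479956797/5000000), slopes −q₀/2 = (41.0366, 44.6365, 44.3771, 47.9957) eV/CuO₂);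
by monotone level transfer and convexity they bind the box at εp = -44/5: **`emeryBoxLa214CLDA_pressureCap_m44o5`** `P_cell ≤ 6 log 2 + 47.9956797·β` (§2) and interpolate on the
`t_pd × t_pp` face (§3, face-centre slope 44.5115). No Rayleigh family exists for this object yet, so no floor / window at T > 0 is stated (the T = 0 floor word is).

Everything PROVED (0 sorry); no definition. HONEST FRAMING: certified inequalities on a SCREENING/EXTRAPOLATED object (U-slice / companion per EMERY-LINE); full entropy
`6 log 2` kept; grand-canonical at the stated level; no phase word; no router number moves.
-/

noncomputable section

namespace Summit.Ventures.CertifiedManyBodySolver.Downfold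

open NonemptyInterval Matrix Finset Literature.Probability.LatticeModels
open Literature.MathematicalPhysics.QuantumLattice Literature.Computation.Certificates
open Summit.Ventures.CertifiedManyBodySolver.Certificates OccupationCode ClusterLowerBound
open scoped BigOperators ComplexOrder

/-! ## §1 Tilts, slopes, exact-tilt corner caps -/

/-- Every tilt is at most the common level `-44/5` (tilts `(-44/5, -47/5, -47/5, -10)`). [folklore] -/
theorem la214CLDAFloor_mu_le_m44o5 (i : Fin 4) : la214CLDAFloor_mu i ≤ ((-44/5 : ℚ) : ℝ) := by
  fin_cases i <;> simp [la214CLDAFloor_mu] <;> norm_num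

/-- Every corner cap slope `−q₀ᵢ/2` is at most `479956797/10000000` = 47.9956797 (corner 3); slopes `(41.0366, 44.6365, 44.3771, 47.9957)` eV per CuO₂ per unit β. [folklore] -/
theorem la214CLDAFloor_capSlope_le (i : Fin 4) : -la214CLDAFloor_q0 i / 2 ≤ (479956797/10000000 : ℝ) := by
  fin_cases i <;> simp [la214CLDAFloor_q0] <;> norm_num

/-- **EXACT-TILT CORNER CAPS** (hypothesis-free, every β ≥ 0): `P_cell(β, emeryLine cuprateSigns (la214CLDACorner i) + μᵢ·levelDir) ≤ 6 log 2 + β·(−q₀ᵢ/2)` — the floor word's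
certificate `la214CLDAFloor_hq_lowerCorner i` through hubbard-box-p1's `emeryCellPressure_le_of_cuO4Certificate`. [cite: Israel1979, Thm. I.2.4] [cite: ValentiStolzeHirschfeld1991, §II] -/
theorem emeryBoxLa214CLDA_corner_pressureCap {β : ℝ} (hβ : 0 ≤ β) (i : Fin 4) :
    emeryCellPressure β (emeryLine cuprateSigns (la214CLDACorner i) + la214CLDAFloor_mu i • levelDir) ≤ 6 * Real.log 2 + β * (-la214CLDAFloor_q0 i / 2) := by
  have h := emeryCellPressure_tiltedCorner_le_of_cuO4Certificate hβ (emeryLine cuprateSigns (la214CLDACorner i)) (la214CLDAFloor_mu i) (M := 2) two_pos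
    (G := (fun _ : Fin 4 => (0 : FermionOp emeryCuO4Window)) i) (fun ω' _ => re_expect_zero_cuO4 ω') (q₀ := la214CLDAFloor_q0 i)
    (by rw [← la214CLDA_lowerCorner]; simpa using la214CLDAFloor_hq_lowerCorner i)
  simpa using h

/-! ## §2 The box cap word at the common level `εp = -44/5` (= max μᵢ; chemical potential 44/5 eV) -/

/-- **THE THERMAL CAP WORD (hypothesis-free)** on `emeryBoxLa214CLDA`, cuprate signs, level `εp = -44/5`, EVERY β ≥ 0, EVERY point of the box:
`P_cell ≤ 6 log 2 + β·479956797/10000000` (47.9957·β + 4.1589). [cite: Israel1979, Thm. I.2.4] [cite: ValentiStolzeHirschfeld1991, §II] -/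
theorem emeryBoxLa214CLDA_pressureCap_m44o5 {β : ℝ} (hβ : 0 ≤ β) :
    HoldsOn (fun p : EmeryCoord → ℝ => emeryCellPressure β (emeryLine cuprateSigns (emeryLineCoords (((-44/5 : ℚ)) : ℝ) p)) ≤ 6 * Real.log 2 + β * (479956797/10000000)) emeryBoxLa214CLDA :=
  holdsOn_emeryCellPressureCap_of_tiltedCuO4Certificates (E := emeryBoxLa214CLDA) (eA := la214Emery_tpd) (eB := la214Emery_tpp) (eD := la214CLDAEmery_Delta) (eUd := la214CLDAEmery_Udd) (eUp := la214CLDAEmery_Upp) (by simp [emeryBoxLa214CLDA, emeryBoxLa214CLDASrc, Function.update]) (by simp [emeryBoxLa214CLDA, emeryBoxLa214CLDASrc, Function.update]) (Function.update_self _ _ _) (by simp [emeryBoxLa214CLDA, emeryBoxLa214CLDASrc, Function.update]) (by simp [emeryBoxLa214CLDA, emeryBoxLa214CLDASrc, Function.update]) cuprateSigns hβ (M := 2) two_pos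
    (fun _ => 0) (fun _ ω' _ => re_expect_zero_cuO4 ω') la214CLDAFloor_mu la214CLDAFloor_q0 la214CLDAFloor_hq_lowerCorner la214CLDAFloor_mu_le_m44o5
    (fun i => by have h := la214CLDAFloor_capSlope_le i; simpa [div_eq_mul_inv] using h)

/-- **Grand-potential reading**: at chemical potential 44/5 eV, every `T > 0`, every point: `Ω/CuO₂ = −P_cell/β ≥ −479956797/10000000 − 6 log 2/β` eV. [cite: Israel1979, Thm. I.2.4] -/
theorem emeryBoxLa214CLDA_grandPotential_ge_m44o5 {β : ℝ} (hβ : 0 < β) :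
    HoldsOn (fun p : EmeryCoord → ℝ => -(479956797/10000000 : ℝ) - 6 * Real.log 2 / β ≤ -emeryCellPressure β (emeryLine cuprateSigns (emeryLineCoords (((-44/5 : ℚ)) : ℝ) p)) / β) emeryBoxLa214CLDA :=
  holdsOn_grandPotential_ge_of_pressureCap cuprateSigns hβ _ (emeryBoxLa214CLDA_pressureCap_m44o5 hβ.le)

/-! ## §3 The bilinear (function-valued) cap on the `t_pd × t_pp` face -/

/-- **BILINEAR THERMAL CAP (hypothesis-free)**, level `εp = -44/5`, EVERY β ≥ 0, EVERY point (face `t_pd ∈ [129/100, 38/25]`, `t_pp ∈ [23/50, 33/50]`; face-centre slope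
44.5115 vs the constant word's 47.9957): `P_cell(β, θ(p)) ≤ Σᵢ wᵢ(t_pd, t_pp)·(6 log 2 + β·(−q₀ᵢ/2))`. [cite: Israel1979, Thm. I.3.4] [cite: ValentiStolzeHirschfeld1991, §II] -/
theorem emeryBoxLa214CLDA_pressureBilinearCap_m44o5 {β : ℝ} (hβ : 0 ≤ β) :
    HoldsOn (fun p : EmeryCoord → ℝ => emeryCellPressure β (emeryLine cuprateSigns (emeryLineCoords (((-44/5 : ℚ)) : ℝ) p)) ≤
      (((38/25 : ℝ) - p .tpd) * ((33/50 : ℝ) - p .tpp) * (6 * Real.log 2 + β * (205183047/5000000)) +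
        (p .tpd - (129/100 : ℝ)) * ((33/50 : ℝ) - p .tpp) * (6 * Real.log 2 + β * (111591211/2500000)) +
        ((38/25 : ℝ) - p .tpd) * (p .tpp - (23/50 : ℝ)) * (6 * Real.log 2 + β * (887542813/20000000)) +
        (p .tpd - (129/100 : ℝ)) * (p .tpp - (23/50 : ℝ)) * (6 * Real.log 2 + β * (479956797/10000000))) / (23/500 : ℝ)) emeryBoxLa214CLDA := by
  have h := holdsOn_emeryCellPressureBilinearCap_of_tiltedCuO4Certificates (E := emeryBoxLa214CLDA) (eA := la214Emery_tpd) (eB := la214Emery_tpp) (eD := la214CLDAEmery_Delta) (eUd := la214CLDAEmery_Udd) (eUp := la214CLDAEmery_Upp) (by simp [emeryBoxLa214CLDA, emeryBoxLa214CLDASrc, Function.update]) (by simp [emeryBoxLa214CLDA, emeryBoxLa214CLDASrc, Function.update]) (Function.update_self _ _ _) (by simp [emeryBoxLa214CLDA, emeryBoxLa214CLDASrc, Function.update]) (by simp [emeryBoxLa214CLDA, emeryBoxLa214CLDASrc, Function.update])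
    (by rw [la214Emery_tpd, Entry.encl_ofEnds_fst, Entry.encl_ofEnds_snd]; norm_num)
    (by rw [la214Emery_tpp, Entry.encl_ofEnds_fst, Entry.encl_ofEnds_snd]; norm_num)
    cuprateSigns hβ (M := 2) two_pos (fun _ => 0) (fun _ ω' _ => re_expect_zero_cuO4 ω') la214CLDAFloor_mu la214CLDAFloor_q0 la214CLDAFloor_hq_lowerCorner
    (εp := -44/5) la214CLDAFloor_mu_le_m44o5
  intro p hp
  have h' := h p hp
  simp only [la214Emery_tpd, la214Emery_tpp, Entry.encl_ofEnds_fst, Entry.encl_ofEnds_snd, la214CLDAFloor_q0,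
    Matrix.cons_val_zero, Matrix.cons_val_one, Matrix.cons_val_two, Matrix.cons_val, Matrix.head_cons, Matrix.tail_cons] at h'
  refine h'.trans (le_of_eq ?_)
  push_cast
  ring

end Summit.Ventures.CertifiedManyBodySolver.Downfold

end
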